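import Summits.Ventures.LatticeQCDFlow.Scaling.HubModeAllocation
import Summits.Ventures.LatticeQCDFlow.Scaling.HubProposalLaw

/-!
HONEST FRAMING: exact (Metropolis-corrected) sampling algorithms for lattice gauge theory; figures
of merit are autocorrelation/cost numbers at stated couplings and volumes; no continuum-physics
claim.

# HubModeDilution — THE PROPOSAL LAW IN THE METASTABLE REGIME: WITH EVERY HUB EDGE LISTED `≥ c` TIMES, THE HUB
# MODE-GAP FLOOR OF `HubModeAllocation` GAINS THE FACTOR `c` IN ITS EXCHANGE TERM —
# `Gap ≥ p(1−t)γ_A·w_⋆·min{t·δ₂·c·K/m, γ₀(1−t)w_0}/(56K)` — SO IN BOTH REGIMES OF CHAPTER J (ONE-SIDED DOMINATION AND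
# SECTOR PERSISTENCE WITH WITHIN-SECTOR RELAXATION) THE PROPOSAL LAW ENTERS ONLY THROUGH THE RAREST HUB EDGE'S
# FREQUENCY `c/m` (lean-2 GEN-23, ours)

Venture-side (OURS).  Cell `lqcd-flow` (pub-lqcd), unit `pub-lqcd-lean-2-g23`, 2026-08-26.  Chapter K, file 16: the
multiplicity version of `Scaling/HubModeBlocks` (J2), `Scaling/HubModeGap` (J3) and `Scaling/HubModeAllocation` (J7).
Setting: the weighted hub scheme `P = t·ptGraphSwap μ e 1 + (1−t)·prodKernel w M` on an edge list `e` of `m` entries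
(distinct endpoints, identity maps) listing every hub edge `(0, k+1)` at least `c ≥ 1` times (`c·K ≤ m`); modes
`mode : S → J` with one-sided persistence `p·μ_{k+1}(A_j) ≤ μ_0(A_j)`, assignment-restricted hub-swap overlap `δ₂`,
within-sector Poincaré constants `γ_A`, hot between-sector constant `γ₀`, update weights `w ≥ w_⋆`.

## What is proved

* §1 **`hubMode_blockFlow_swap_ge_mult`**, **`hubMode_proj_swap_mult`** — the assignment chain's star-transposition
  flows are `≥ (t·c·δ₂/m)·min{π̄(m), π̄(m∘τ_k)}` (J2 had `t·δ₂/m`).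
* §2 **`hubMode_projection_poincare_mult`**, **`hubMode_spectralGap_ge_mult`** — J3's projection Poincaré inequality and
  JSTV gap floor with `C·6m ≤ p·t·c·δ₂` in place of `C·6m ≤ p·t·δ₂`.
* §3 **`hubModeWeighted_spectralGap_ge_mult`** — closed form:
  **`Gap ≥ p(1−t)γ_A·w_⋆·min{t·δ₂·c·K/m, γ₀(1−t)w_0}/(56K)`** (`w ≥ w_⋆ > 0`, `p, δ₂, γ_A ≤ 1`, `c·K ≤ m`).

Reading (no numerics implied): when the cold replicas are metastable rather than dominated, the exchange term of the
hub floor is still the rarest hub edge's proposal frequency `c/m` times the sector-wise acceptance `δ₂`; a proposal law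
over the pairs of replicas therefore has the same linear price in both regimes, and the uniform hub (`c/m = 1/K`) is
again the best the class offers (`Scaling/HubProposalLaw`, `exists_hubMult_le`).  NOT CLAIMED: the matching ceiling in
this regime (open: `K⁻¹` vs `K⁻²` for the balanced star without pointwise domination); maps (J4's transfer applies
verbatim); continuous spaces; anything measured.  Literature grade (cell rule): OWN COMPOSITION (J2/J3/J7 with K2's
multiplicity flows); nothing cited as a fact; no new bib keys.
-/

noncomputable section

open Finset Function
open Literature.Probability.MarkovChains
open Literature.Probability.MarkovChains.Decomposition

namespace Summit.Ventures.LatticeQCDFlow.Scaling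

section HubModeDilution

variable {S J : Type*} [Fintype S] [DecidableEq S] [Fintype J] [DecidableEq J] {K m : ℕ}
  {μ : Fin (K + 1) → S → ℝ} (hμ : ∀ k x, 0 < μ k x) (hμ1 : ∀ k, ∑ x, μ k x = 1)
  {M : Fin (K + 1) → S → S → ℝ} {w : Fin (K + 1) → ℝ} {mode : S → J} (hmode : Function.Surjective mode) {t : ℝ}
  {e : Fin m → Fin (K + 1) × Fin (K + 1)}

/-! ## §1 Block flows of the hub swaps with multiplicity -/

include hμ in
omit [Fintype J] in
/-- **Hub-swap block flows with multiplicity:** every hub edge listed `≥ c` times ⇒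
`(t·c/m)·Σ_{x ∈ B_m} min{π̃(x), π̃(x∘τ_k)} ≤ blockFlow(P)(m, m∘τ_k)` for assignments `m` moved by `τ_k`. [ours] -/
theorem hubMode_blockFlow_swap_ge_mult (he : ∀ r, (e r).1 ≠ (e r).2) (hM : ∀ k, IsRowStochastic (M k))
    (hw0 : ∀ k, 0 ≤ w k) (hw1 : ∑ k, w k = 1) (ht0 : 0 ≤ t) (ht1 : t ≤ 1) {c : ℕ}
    (hc : ∀ k : Fin K, c ≤ (univ.filter (fun r : Fin m => e r = ((0 : Fin (K + 1)), k.succ))).card)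
    (i : Fin (K + 1) → J) (k : Fin K) (hik : i ∘ Equiv.swap (0 : Fin (K + 1)) k.succ ≠ i) :
    t * c / m * ∑ x ∈ block (fun z : Fin (K + 1) → S => mode ∘ z) i,
        min (tensorFun μ x) (tensorFun μ (x ∘ Equiv.swap (0 : Fin (K + 1)) k.succ))
      ≤ blockFlow (tensorFun μ) (fun x y : Fin (K + 1) → S =>
            t * ptGraphSwap μ e (fun _ : Fin m => Equiv.refl S) x y + (1 - t) * prodKernel w M x y)
          (fun z : Fin (K + 1) → S => mode ∘ z) i (i ∘ Equiv.swap (0 : Fin (K + 1)) k.succ) := by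
  unfold blockFlow
  rw [mul_sum]
  refine sum_le_sum fun x hx => ?_
  have hxm : mode ∘ x = i := mem_block.mp hx
  have hy : x ∘ Equiv.swap (0 : Fin (K + 1)) k.succ
      ∈ block (fun z : Fin (K + 1) → S => mode ∘ z) (i ∘ Equiv.swap (0 : Fin (K + 1)) k.succ) := by
    rw [mem_block, modes_comp_starSwap, hxm]
  have hxfix : x ∘ Equiv.swap (0 : Fin (K + 1)) k.succ ≠ x := by
    intro hfix
    apply hik
    rw [← hxm, ← modes_comp_starSwap, hfix]
  calc t * c / m * min (tensorFun μ x) (tensorFun μ (x ∘ Equiv.swap (0 : Fin (K + 1)) k.succ))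
      ≤ tensorFun μ x * (t * ptGraphSwap μ e (fun _ : Fin m => Equiv.refl S) x (x ∘ Equiv.swap (0 : Fin (K + 1)) k.succ)
          + (1 - t) * prodKernel w M x (x ∘ Equiv.swap (0 : Fin (K + 1)) k.succ)) :=
        multiHub_swap_flow_ge e he hμ hM hw0 hw1 ht0 ht1 hc x k hxfix
    _ ≤ ∑ y ∈ block (fun z : Fin (K + 1) → S => mode ∘ z) (i ∘ Equiv.swap (0 : Fin (K + 1)) k.succ),
          tensorFun μ x * (t * ptGraphSwap μ e (fun _ : Fin m => Equiv.refl S) x y + (1 - t) * prodKernel w M x y) :=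
        single_le_sum (f := fun y => tensorFun μ x
            * (t * ptGraphSwap μ e (fun _ : Fin m => Equiv.refl S) x y + (1 - t) * prodKernel w M x y))
          (fun y _ => mul_nonneg (tensorFun_pos hμ x).le (whub_nonneg hμ hM hw0 hw1 ht0 ht1 x y)) hy

include hμ hmode in
omit [Fintype J] in
/-- **Hypothesis `hT` of `starConveyor_poincare` for the projection chain, with multiplicity:**
`(t·c·δ₂/m)·min{π̄(m), π̄(m∘τ_k)} ≤ π̄(m)·P̄(m, m∘τ_k)`. [ours] -/
theorem hubMode_proj_swap_mult (he : ∀ r, (e r).1 ≠ (e r).2) (hM : ∀ k, IsRowStochastic (M k))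
    (hw0 : ∀ k, 0 ≤ w k) (hw1 : ∑ k, w k = 1) (ht0 : 0 ≤ t) (ht1 : t ≤ 1) {c : ℕ}
    (hc : ∀ k : Fin K, c ≤ (univ.filter (fun r : Fin m => e r = ((0 : Fin (K + 1)), k.succ))).card) {δ₂ : ℝ}
    (hδ : ∀ (i : Fin (K + 1) → J) (k : Fin K), i ∘ Equiv.swap (0 : Fin (K + 1)) k.succ ≠ i →
      δ₂ * min (blockMass (tensorFun μ) (fun z : Fin (K + 1) → S => mode ∘ z) i)
          (blockMass (tensorFun μ) (fun z : Fin (K + 1) → S => mode ∘ z) (i ∘ Equiv.swap (0 : Fin (K + 1)) k.succ))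
        ≤ ∑ x ∈ block (fun z : Fin (K + 1) → S => mode ∘ z) i,
            min (tensorFun μ x) (tensorFun μ (x ∘ Equiv.swap (0 : Fin (K + 1)) k.succ)))
    (i : Fin (K + 1) → J) (k : Fin K) (hik : i ∘ Equiv.swap (0 : Fin (K + 1)) k.succ ≠ i) :
    t * c * δ₂ / m * min (tensorFun (fun k => blockMass (μ k) mode) i)
        (tensorFun (fun k => blockMass (μ k) mode) (i ∘ Equiv.swap (0 : Fin (K + 1)) k.succ))
      ≤ tensorFun (fun k => blockMass (μ k) mode) i
          * projectionChain (tensorFun μ) (fun x y : Fin (K + 1) → S =>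
                t * ptGraphSwap μ e (fun _ : Fin m => Equiv.refl S) x y + (1 - t) * prodKernel w M x y)
              (fun z : Fin (K + 1) → S => mode ∘ z) i (i ∘ Equiv.swap (0 : Fin (K + 1)) k.succ) := by
  rw [← ptBareMode_blockMass i, ← ptBareMode_blockMass (i ∘ Equiv.swap (0 : Fin (K + 1)) k.succ),
    blockMass_mul_projectionChain (ptBareMode_blockMass_pos hμ hmode i).ne']
  have htc : 0 ≤ t * c / m := by positivity
  calc t * c * δ₂ / m * min (blockMass (tensorFun μ) (fun z : Fin (K + 1) → S => mode ∘ z) i)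
        (blockMass (tensorFun μ) (fun z : Fin (K + 1) → S => mode ∘ z) (i ∘ Equiv.swap (0 : Fin (K + 1)) k.succ))
      = t * c / m * (δ₂ * min (blockMass (tensorFun μ) (fun z : Fin (K + 1) → S => mode ∘ z) i)
          (blockMass (tensorFun μ) (fun z : Fin (K + 1) → S => mode ∘ z) (i ∘ Equiv.swap (0 : Fin (K + 1)) k.succ))) := by
        ring
    _ ≤ t * c / m * ∑ x ∈ block (fun z : Fin (K + 1) → S => mode ∘ z) i,
          min (tensorFun μ x) (tensorFun μ (x ∘ Equiv.swap (0 : Fin (K + 1)) k.succ)) :=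
        mul_le_mul_of_nonneg_left (hδ i k hik) htc
    _ ≤ _ := hubMode_blockFlow_swap_ge_mult hμ he hM hw0 hw1 ht0 ht1 hc i k hik

/-! ## §2 The projection Poincaré inequality and the gap floor with multiplicity -/

include hμ hμ1 hmode in
/-- **THE PROJECTION CHAIN'S POINCARÉ CONSTANT WITH MULTIPLICITY** (star conveyor with `κ = t·c·δ₂/m`, `ρ = γ₀`,
`θ = (1−t)w_0`, one-sided persistence `p`): for every `C ≥ 0` with `C·6m ≤ p·t·c·δ₂` and `C·2(p+6K) ≤ pγ₀(1−t)w_0`,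
`C·Var_π̄(g) ≤ 𝓔_π̄(P̄; g)`. [ours] -/
theorem hubMode_projection_poincare_mult (hm : 1 ≤ m) (he : ∀ r, (e r).1 ≠ (e r).2) {c : ℕ}
    (hc : ∀ k : Fin K, c ≤ (univ.filter (fun r : Fin m => e r = ((0 : Fin (K + 1)), k.succ))).card) (hc1 : 1 ≤ c)
    (hM : ∀ k, IsRowStochastic (M k)) (hw0 : ∀ k, 0 ≤ w k) (hw1 : ∑ k, w k = 1) (hwhot : 0 < w 0) (ht0 : 0 < t)
    (ht1 : t < 1) {p δ₂ γ₀ : ℝ} (hp : 0 < p) (hδ0 : 0 < δ₂) (hγ₀ : 0 < γ₀)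
    (hpers : ∀ (k : Fin K) (j : J), p * blockMass (μ k.succ) mode j ≤ blockMass (μ 0) mode j)
    (hδ : ∀ (i : Fin (K + 1) → J) (k : Fin K), i ∘ Equiv.swap (0 : Fin (K + 1)) k.succ ≠ i →
      δ₂ * min (blockMass (tensorFun μ) (fun z : Fin (K + 1) → S => mode ∘ z) i)
          (blockMass (tensorFun μ) (fun z : Fin (K + 1) → S => mode ∘ z) (i ∘ Equiv.swap (0 : Fin (K + 1)) k.succ))
        ≤ ∑ x ∈ block (fun z : Fin (K + 1) → S => mode ∘ z) i,
            min (tensorFun μ x) (tensorFun μ (x ∘ Equiv.swap (0 : Fin (K + 1)) k.succ)))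
    (hgap0 : ∀ h : J → ℝ, γ₀ * lawVariance (blockMass (μ 0) mode) h
      ≤ dirichletForm (blockMass (μ 0) mode) (projectionChain (μ 0) (M 0) mode) h)
    {C : ℝ} (hC0 : 0 ≤ C) (hC1 : C * (6 * m) ≤ p * (t * c * δ₂))
    (hC2 : C * (2 * (p + 6 * K)) ≤ p * γ₀ * ((1 - t) * w 0)) (g : (Fin (K + 1) → J) → ℝ) :
    C * lawVariance (blockMass (tensorFun μ) (fun z : Fin (K + 1) → S => mode ∘ z)) g
      ≤ dirichletForm (blockMass (tensorFun μ) (fun z : Fin (K + 1) → S => mode ∘ z))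
          (projectionChain (tensorFun μ) (fun x y : Fin (K + 1) → S =>
              t * ptGraphSwap μ e (fun _ : Fin m => Equiv.refl S) x y + (1 - t) * prodKernel w M x y)
            (fun z : Fin (K + 1) → S => mode ∘ z)) g := by
  have hlaw : blockMass (tensorFun μ) (fun z : Fin (K + 1) → S => mode ∘ z)
      = tensorFun (fun k => blockMass (μ k) mode) := funext ptBareMode_blockMass
  have hmpos : (0 : ℝ) < m := Nat.cast_pos.mpr (by omega)
  have hcpos : (0 : ℝ) < c := Nat.cast_pos.mpr (by omega)
  have hP := weightedScheme_isRowStochastic (t := t) (w := w)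
    (ptGraphSwap_isRowStochastic (e := e) (φ := fun _ : Fin m => Equiv.refl S) hμ) hM hw0 hw1 ht0.le ht1.le
  rw [hlaw]
  refine starConveyor_poincare (ν := fun k => blockMass (μ k) mode)
    (Q := projectionChain (tensorFun μ) (fun x y : Fin (K + 1) → S =>
        t * ptGraphSwap μ e (fun _ : Fin m => Equiv.refl S) x y + (1 - t) * prodKernel w M x y)
      (fun z : Fin (K + 1) → S => mode ∘ z))
    (fun k j => blockMass_pos (hμ k) hmode j) (fun k => by rw [sum_blockMass, hμ1 k]) hp hpers
    (by positivity : 0 < t * c * δ₂ / m) hγ₀ (mul_pos (by linarith) hwhot : (0 : ℝ) < (1 - t) * w 0)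
    (projectionChain_nonneg (fun x => (tensorFun_pos hμ x).le) hP.1 _) ?_ hgap0 ?_ g hC0 ?_ ?_
  · intro z k hzk
    exact hubMode_proj_swap_mult (M := M) (w := w) hμ hmode he hM hw0 hw1 ht0.le ht1.le hc hδ z k hzk
  · intro z v hv
    exact hubMode_proj_relabel (M := M) (w := w) (e := e) hμ hmode hM hw0 hw1 ht0.le ht1.le z v hv
  · rw [show p * (t * c * δ₂ / m) = p * (t * c * δ₂) / m by ring, le_div_iff₀ hmpos]
    calc C * 6 * m = C * (6 * m) := by ring
      _ ≤ p * (t * c * δ₂) := hC1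
  · exact hC2

include hμ hμ1 hmode in
/-- **THE JSTV GAP FLOOR OF THE WEIGHTED HUB SCHEME WITH MULTIPLICITY:** `Gap(P) ≥ min{C/3, C·λ_A/(3 + C)}`,
`λ_A = (1−t)c_w` with `c_w ≤ w_kγ_A`, for every `C > 0` with `C·6m ≤ p·t·c·δ₂` and `C·2(p+6K) ≤ pγ₀(1−t)w_0`.
[ours] -/
theorem hubMode_spectralGap_ge_mult [Nontrivial S] (hm : 1 ≤ m) (he : ∀ r, (e r).1 ≠ (e r).2) {c : ℕ}
    (hc : ∀ k : Fin K, c ≤ (univ.filter (fun r : Fin m => e r = ((0 : Fin (K + 1)), k.succ))).card) (hc1 : 1 ≤ c)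
    (hM : ∀ k, IsRowStochastic (M k)) (hMrev : ∀ k, DetailedBalance (μ k) (M k)) (hw0 : ∀ k, 0 ≤ w k)
    (hw1 : ∑ k, w k = 1) (hwhot : 0 < w 0) (ht0 : 0 < t) (ht1 : t < 1) {p δ₂ γ₀ γA cw : ℝ} (hp : 0 < p)
    (hδ0 : 0 < δ₂) (hγ₀ : 0 < γ₀) (hcw0 : 0 < cw) (hcw : ∀ k, cw ≤ w k * γA)
    (hpers : ∀ (k : Fin K) (j : J), p * blockMass (μ k.succ) mode j ≤ blockMass (μ 0) mode j)
    (hδ : ∀ (i : Fin (K + 1) → J) (k : Fin K), i ∘ Equiv.swap (0 : Fin (K + 1)) k.succ ≠ i →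
      δ₂ * min (blockMass (tensorFun μ) (fun z : Fin (K + 1) → S => mode ∘ z) i)
          (blockMass (tensorFun μ) (fun z : Fin (K + 1) → S => mode ∘ z) (i ∘ Equiv.swap (0 : Fin (K + 1)) k.succ))
        ≤ ∑ x ∈ block (fun z : Fin (K + 1) → S => mode ∘ z) i,
            min (tensorFun μ x) (tensorFun μ (x ∘ Equiv.swap (0 : Fin (K + 1)) k.succ)))
    (hgap0 : ∀ h : J → ℝ, γ₀ * lawVariance (blockMass (μ 0) mode) h
      ≤ dirichletForm (blockMass (μ 0) mode) (projectionChain (μ 0) (M 0) mode) h)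
    (hgapA : ∀ k j, ∀ h : S → ℝ, γA * lawVariance (blockLaw (μ k) mode j) h
      ≤ dirichletForm (blockLaw (μ k) mode j) (restrictionChain (M k) mode) h)
    {C : ℝ} (hC0 : 0 < C) (hC1 : C * (6 * m) ≤ p * (t * c * δ₂))
    (hC2 : C * (2 * (p + 6 * K)) ≤ p * γ₀ * ((1 - t) * w 0)) :
    min (C / 3) (C * ((1 - t) * cw) / (3 * 1 + C))
      ≤ spectralGap (tensorFun μ) (fun x y : Fin (K + 1) → S =>
          t * ptGraphSwap μ e (fun _ : Fin m => Equiv.refl S) x y + (1 - t) * prodKernel w M x y) := by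
  have hQ := ptGraphSwap_isRowStochastic (e := e) (φ := fun _ : Fin m => Equiv.refl S) hμ
  have hP := weightedScheme_isRowStochastic (t := t) (w := w) hQ hM hw0 hw1 ht0.le ht1.le
  exact JerrumEtAl2004_thm_1_spectralGap (tensorFun_pos hμ) (sum_tensorFun_eq_one μ hμ1) hP
    (weightedScheme_detailedBalance (ptGraphSwap_detailedBalance hμ) hMrev t)
    (modes_surjective hmode) hC0 (mul_pos (by linarith) hcw0) zero_le_one
    (hubMode_projection_poincare_mult hμ hμ1 hmode hm he hc hc1 hM hw0 hw1 hwhot ht0 ht1 hp hδ0 hγ₀ hpers hδ hgap0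
      hC0.le hC1 hC2)
    (fun i f => hubMode_restriction_poincare (e := e) hμ hmode hM hw0 ht0.le ht1.le hcw hgapA i f)
    (fun x => escapeProb_le_one' hP _ x)

/-! ## §3 The closed form -/

include hμ hμ1 hmode in
/-- **THE HUB MODE-GAP FLOOR WITH MULTIPLICITY, CLOSED FORM:** every hub edge listed `≥ c ≥ 1` times with `c·K ≤ m`,
weights `w ≥ w_⋆ > 0`, `0 < t < 1`, `p, δ₂, γ_A ≤ 1`:
**`Gap ≥ p(1−t)γ_A·w_⋆·min{t·δ₂·c·K/m, γ₀(1−t)w_0}/(56K)`**. [ours] -/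
theorem hubModeWeighted_spectralGap_ge_mult [Nontrivial S] (hK : 1 ≤ K) (he : ∀ r, (e r).1 ≠ (e r).2) {c : ℕ}
    (hc : ∀ k : Fin K, c ≤ (univ.filter (fun r : Fin m => e r = ((0 : Fin (K + 1)), k.succ))).card) (hc1 : 1 ≤ c)
    (hcm : c * K ≤ m) (hM : ∀ k, IsRowStochastic (M k)) (hMrev : ∀ k, DetailedBalance (μ k) (M k))
    (hw0 : ∀ k, 0 ≤ w k) (hw1 : ∑ k, w k = 1) {wmin : ℝ} (hwmin0 : 0 < wmin) (hwmin : ∀ k, wmin ≤ w k)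
    (ht0 : 0 < t) (ht1 : t < 1) {p δ₂ γ₀ γA : ℝ} (hp : 0 < p) (hp1 : p ≤ 1) (hδ0 : 0 < δ₂) (hδ1 : δ₂ ≤ 1)
    (hγ₀ : 0 < γ₀) (hγA : 0 < γA) (hγA1 : γA ≤ 1)
    (hpers : ∀ (k : Fin K) (j : J), p * blockMass (μ k.succ) mode j ≤ blockMass (μ 0) mode j)
    (hδ : ∀ (i : Fin (K + 1) → J) (k : Fin K), i ∘ Equiv.swap (0 : Fin (K + 1)) k.succ ≠ i →
      δ₂ * min (blockMass (tensorFun μ) (fun z : Fin (K + 1) → S => mode ∘ z) i)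
          (blockMass (tensorFun μ) (fun z : Fin (K + 1) → S => mode ∘ z) (i ∘ Equiv.swap (0 : Fin (K + 1)) k.succ))
        ≤ ∑ x ∈ block (fun z : Fin (K + 1) → S => mode ∘ z) i,
            min (tensorFun μ x) (tensorFun μ (x ∘ Equiv.swap (0 : Fin (K + 1)) k.succ)))
    (hgap0 : ∀ h : J → ℝ, γ₀ * lawVariance (blockMass (μ 0) mode) h
      ≤ dirichletForm (blockMass (μ 0) mode) (projectionChain (μ 0) (M 0) mode) h)
    (hgapA : ∀ k j, ∀ h : S → ℝ, γA * lawVariance (blockLaw (μ k) mode j) h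
      ≤ dirichletForm (blockLaw (μ k) mode j) (restrictionChain (M k) mode) h) :
    p * (1 - t) * γA * wmin * min (t * δ₂ * c * K / m) (γ₀ * (1 - t) * w 0) / (56 * K)
      ≤ spectralGap (tensorFun μ) (fun x y : Fin (K + 1) → S =>
          t * ptGraphSwap μ e (fun _ : Fin m => Equiv.refl S) x y + (1 - t) * prodKernel w M x y) := by
  have hKr : (1 : ℝ) ≤ K := by exact_mod_cast hK
  have hK0 : (0 : ℝ) < K := by linarith
  have hcr : (1 : ℝ) ≤ c := by exact_mod_cast hc1
  have hcK : (c : ℝ) * K ≤ m := by exact_mod_cast hcm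
  have hm1 : 1 ≤ m := by
    have : 1 * 1 ≤ c * K := Nat.mul_le_mul hc1 hK
    omega
  have hm0 : (0 : ℝ) < m := Nat.cast_pos.mpr (by omega)
  have h1t : 0 < 1 - t := by linarith
  have hwhot : 0 < w 0 := lt_of_lt_of_le hwmin0 (hwmin 0)
  have hw0le : w 0 ≤ 1 := by
    calc w 0 ≤ ∑ k, w k := single_le_sum (fun k _ => hw0 k) (mem_univ 0)
      _ = 1 := hw1
  have hwminle : wmin ≤ 1 := (hwmin 0).trans hw0le
  set m₀ := min (t * δ₂ * c * K / m) (γ₀ * (1 - t) * w 0) with hm₀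
  have hm₀pos : 0 < m₀ := lt_min (by positivity) (by positivity)
  have hm₀le : m₀ ≤ 1 := by
    have h1 : m₀ ≤ t * δ₂ * c * K / m := min_le_left _ _
    have h2 : t * δ₂ * c * K / m ≤ 1 := by
      rw [div_le_one hm0]
      calc t * δ₂ * c * K ≤ 1 * 1 * (c * K) := by
            rw [show t * δ₂ * c * K = t * δ₂ * (c * K) by ring]
            exact mul_le_mul (mul_le_mul ht1.le hδ1 hδ0.le zero_le_one) le_rfl (by positivity) (by positivity)
        _ = c * K := by ring
        _ ≤ m := hcK
    exact h1.trans h2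
  -- the admissible constant `C = p m₀/(14K)`
  set C := p * m₀ / (14 * K) with hC
  have hCpos : 0 < C := by positivity
  have hC1 : C * (6 * m) ≤ p * (t * c * δ₂) := by
    have h1 : m₀ ≤ t * δ₂ * c * K / m := min_le_left _ _
    have h1' : m₀ * m ≤ t * δ₂ * c * K := by rwa [le_div_iff₀ hm0] at h1
    rw [hC]
    calc p * m₀ / (14 * K) * (6 * m) = p * (m₀ * m) * (6 / (14 * K)) := by field_simp
      _ ≤ p * (t * δ₂ * c * K) * (6 / (14 * K)) := by
          refine mul_le_mul_of_nonneg_right (mul_le_mul_of_nonneg_left h1' hp.le) (by positivity)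
      _ = p * (t * c * δ₂) * (6 / 14) := by field_simp
      _ ≤ p * (t * c * δ₂) := by nlinarith [mul_pos hp (mul_pos (mul_pos ht0 (by positivity : (0 : ℝ) < c)) hδ0)]
  have hC2 : C * (2 * (p + 6 * K)) ≤ p * γ₀ * ((1 - t) * w 0) := by
    have h2 : m₀ ≤ γ₀ * (1 - t) * w 0 := min_le_right _ _
    have h3 : 2 * (p + 6 * (K : ℝ)) ≤ 14 * K := by nlinarith
    rw [hC]
    calc p * m₀ / (14 * K) * (2 * (p + 6 * K)) ≤ p * m₀ / (14 * K) * (14 * K) :=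
          mul_le_mul_of_nonneg_left h3 (by positivity)
      _ = p * m₀ := by field_simp
      _ ≤ p * (γ₀ * (1 - t) * w 0) := mul_le_mul_of_nonneg_left h2 hp.le
      _ = p * γ₀ * ((1 - t) * w 0) := by ring
  have hcw : ∀ k : Fin (K + 1), wmin * γA ≤ w k * γA := fun k => mul_le_mul_of_nonneg_right (hwmin k) hγA.le
  have key := hubMode_spectralGap_ge_mult hμ hμ1 hmode hm1 he hc hc1 hM hMrev hw0 hw1 hwhot ht0 ht1 hp hδ0 hγ₀
    (mul_pos hwmin0 hγA) hcw hpers hδ hgap0 hgapA hCpos hC1 hC2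
  refine le_trans ?_ key
  have hCle : C ≤ 1 / 14 := by
    rw [hC, div_le_iff₀ (by positivity)]
    have : p * m₀ ≤ 1 := by nlinarith
    nlinarith
  have hval : p * (1 - t) * γA * wmin * m₀ / (56 * K) = C * ((1 - t) * (wmin * γA)) / 4 := by
    rw [hC]; field_simp; ring
  rw [hval]
  have hlam : (1 - t) * (wmin * γA) ≤ 1 := by
    have h1 : 1 - t ≤ 1 := by linarith
    have h2 : wmin * γA ≤ 1 := by nlinarith
    calc (1 - t) * (wmin * γA) ≤ 1 * 1 := mul_le_mul h1 h2 (by positivity) zero_le_one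
      _ = 1 := by ring
  refine le_min ?_ ?_
  · rw [div_le_div_iff₀ (by norm_num) (by norm_num)]
    nlinarith [mul_le_mul_of_nonneg_left hlam hCpos.le]
  · rw [show (3 : ℝ) * 1 + C = 3 + C by ring, div_le_div_iff₀ (by norm_num) (by positivity)]
    have h3 : 3 + C ≤ 4 := by linarith
    exact mul_le_mul_of_nonneg_left h3 (by positivity)

end HubModeDilution

end Summit.Ventures.LatticeQCDFlow.Scaling

end
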